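import Summits.ResolutionOfSingularities.ResolutionOfSingularities.Theorems.PurelyInseparableDim4RidgeBudget
import Summits.ResolutionOfSingularities.ResolutionOfSingularities.Theorems.PurelyInseparableDim4IsolatedConeOneFree
import HarnessLib
import HarnessLib.Audit.Tags

/-!
# The NARROW LINE of the ridge trichotomy — L3 `RidgeTransversal p p` (cell `res-dim4-pi`)

[OURS · counted 0 · CARD I-3-10 of seat res-dim4-idea-3 (hand proof `iso6/N1-PROOF-v2.md` §L3,
typed stub `RidgeBudget.RidgeTransversal` in `NarrowLine.lean` 12405623f2353fc4; independent hand
proof at `q = 3`: res-dim4-crit-4 V-A4-09); split of record desk WORD #43 (a) / #44: L0/L1/assembly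
= p-1 g2, L2 = p-5 g2, **L3 = p-7 g2 (this file)**.  Nothing here proves `NarrowDrop`, F4-I(p,p), or
resolution of singularities in dimension ≥ 4 / characteristic `p`.]

**L3 (ridge transversality).**  Let `s` be a frame state of order exactly `p` whose tangent cone has a
ONE-dimensional ridge, `ē(s) = dim_K A(in s.F) = 1` (`RidgeBudget.ebar`), and let `(j, b)` (`b_j = 0`)
be an equimultiple point of the point blow-up (then the direction `e_j + b` spans the ridge,
`additiveSubspace_eq_span_direction`).  For the CLEANED successor `s⁺ = CentreBlowup.step p univ j b s`:

* `ordZero_step_eq` — `ord₀ s⁺.F = p`; `ebar_step_le_one` — `ē(s⁺) ≤ 1` (tree: [CJS 2020] Thm 3.10 (4),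
  `Directrix.finrank_additiveSubspace_step_le`);
* **`eq_zero_of_mem_additiveSubspace_step`** — every `w' ∈ A(in s⁺.F)` tangent to the exceptional
  hyperplane (`w'_j = 0`) is `0`: if `ē(s⁺) = 0` trivially; if `ē(s⁺) = 1 = ē(s)` the point is VERY
  NEAR and `A(in s⁺.F) ⋔ {w_j = 0}` ([CJS 2020] Def. 3.13 (2) / Thm 9.3, tree
  `IsolatedBand.isTransversal_of_finrank_eq`), so a non-zero ridge vector has `w'_j ≠ 0`;
* `ridgeTransversal` — the LITERAL body of idea-3's stub `RidgeBudget.RidgeTransversal p p` (the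
  one-line adapter `fun K _ _ _ => ridgeTransversal p K` is added when that defs file lands);
* `exists_ridge_vector_step` / `additiveSubspace_step_eq_span` — in the case `ē(s⁺) = 1` the new ridge
  is a line `K·w'` with `w'_j ≠ 0`, so L1 applies to `s⁺` in the SAME chart coordinate `x_j` (the
  form in which the `NarrowDrop` assembly consumes L3).

Pure frame reading of tree theorems; no new definition.  bears_on: LADDER-RESOLUTION:D157-DOOR2
(res-dim4-pi · F4-I(p,p) narrow branch · L3).  Supports stmt-ResolutionOfSingularities-16155 (helper).
-/

set_option linter.dupNamespace false -- mandated namespace of this single-conjunct summit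

noncomputable section

namespace Summit.ResolutionOfSingularities.ResolutionOfSingularities.Theorems.PIDim4

namespace NarrowTransversal

open MvPolynomial Finset
open Literature.AlgebraicGeometry.Resolution
open Literature.AlgebraicGeometry.Resolution.Hauser2010
open Literature.AlgebraicGeometry.Resolution.HauserPerlega2019
open PointBlowup (direction gradSpan additiveSubspace IsTransversal)

variable {K : Type} [Field K]

/-! ## 1. A one-dimensional ridge: `∇ ≠ 0`, and the equimultiple direction spans it -/

/-- `ē(F) = 1` forces `∇(in F) ≠ 0` (`dim A + dim ∇ = 4`). [folklore] -/
theorem gradSpan_ne_bot_of_ebar_eq_one {F : MvPolynomial (Fin 4) K} (he : RidgeBudget.ebar F = 1) :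
    gradSpan (initialForm F) ≠ ⊥ :=
  (Directrix.gradSpan_ne_bot_iff_finrank_additiveSubspace_le _).mpr (by
    rw [RidgeBudget.ebar] at he
    omega)

/-- **The equimultiple direction spans the ridge.**  At a state of order `p` with `ē = 1`, for an
equimultiple point `(j, b)` of the point blow-up: `A(in s.F) = K·(e_j + b)` — the direction lies in
`A` ([CJS 2020] Thm 3.14, tree `Directrix.direction_mem_additiveSubspace`), is non-zero, and `A` is a
line. [cite: CossartJannsenSaito2020, Thm. 3.14] -/
theorem additiveSubspace_eq_span_direction (p : ℕ) [Fact p.Prime] [CharP K p] {s : State K}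
    (hord : ordZero s.F = p) (he : RidgeBudget.ebar s.F = 1) {j : Fin 4} {b : Fin 4 → K}
    (hbj : b j = 0) (heq : CentreBlowup.IsEquimultiplePoint p Finset.univ j b s) :
    additiveSubspace (initialForm s.F) = K ∙ direction j b := by
  rw [RidgeBudget.ebar] at he
  have hmem : direction j b ∈ additiveSubspace (initialForm s.F) :=
    Directrix.direction_mem_additiveSubspace p hord hbj heq
  have hle : K ∙ direction j b ≤ additiveSubspace (initialForm s.F) :=
    (Submodule.span_singleton_le_iff_mem _ _).mpr hmem
  refine (Submodule.eq_of_le_of_finrank_eq hle ?_).symm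
  rw [finrank_span_singleton (Directrix.direction_ne_zero j b), he]

/-- The ridge vector of a narrow state read in the chart `x_j` of its equimultiple point: every
`w ∈ A(in s.F)` is a multiple of the direction, so `w ≠ 0 → w_j ≠ 0`. [folklore] -/
theorem apply_ne_zero_of_mem_additiveSubspace (p : ℕ) [Fact p.Prime] [CharP K p] {s : State K}
    (hord : ordZero s.F = p) (he : RidgeBudget.ebar s.F = 1) {j : Fin 4} {b : Fin 4 → K}
    (hbj : b j = 0) (heq : CentreBlowup.IsEquimultiplePoint p Finset.univ j b s)
    {w : Fin 4 → K} (hw : w ∈ additiveSubspace (initialForm s.F)) (hw0 : w ≠ 0) : w j ≠ 0 := by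
  rw [additiveSubspace_eq_span_direction p hord he hbj heq, Submodule.mem_span_singleton] at hw
  obtain ⟨c, rfl⟩ := hw
  have hc : c ≠ 0 := by
    rintro rfl
    exact hw0 (zero_smul K _)
  rw [Pi.smul_apply, smul_eq_mul, direction, Function.update_self, mul_one]
  exact hc

/-! ## 2. The cleaned successor at a ridge point: order `p`, `ē ≤ 1` -/

section Step

variable [DecidableEq K]

/-- Order stays `p` across the edge (tree `Directrix.ordZero_step_eq`, `∇ ≠ 0` from `ē = 1`).
[cite: CossartJannsenSaito2020, Thm. 3.10 (4)] -/
theorem ordZero_step_eq (p : ℕ) [Fact p.Prime] [CharP K p] {s : State K} (hord : ordZero s.F = p)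
    (he : RidgeBudget.ebar s.F = 1) {j : Fin 4} {b : Fin 4 → K} (hbj : b j = 0)
    (heq : CentreBlowup.IsEquimultiplePoint p Finset.univ j b s) :
    ordZero (CentreBlowup.step p Finset.univ j b s).F = p :=
  Directrix.ordZero_step_eq p hord (gradSpan_ne_bot_of_ebar_eq_one he) hbj heq

/-- **`ē(s⁺) ≤ 1`**: the ridge dimension does not increase ([CJS 2020] Thm 3.10 (4), tree
`Directrix.finrank_additiveSubspace_step_le`). [cite: CossartJannsenSaito2020, Thm. 3.10 (4)] -/
theorem ebar_step_le_one (p : ℕ) [Fact p.Prime] [CharP K p] {s : State K} (hord : ordZero s.F = p)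
    (he : RidgeBudget.ebar s.F = 1) {j : Fin 4} {b : Fin 4 → K} (hbj : b j = 0)
    (heq : CentreBlowup.IsEquimultiplePoint p Finset.univ j b s) :
    RidgeBudget.ebar (CentreBlowup.step p Finset.univ j b s).F ≤ 1 := by
  have h := Directrix.finrank_additiveSubspace_step_le p hord (gradSpan_ne_bot_of_ebar_eq_one he)
    hbj heq
  rw [RidgeBudget.ebar] at he ⊢
  omega

/-- The dichotomy `ē(s⁺) = 0 ∨ ē(s⁺) = 1`. [cite: CossartJannsenSaito2020, Thm. 3.10 (4)] -/
theorem ebar_step_eq_zero_or_eq_one (p : ℕ) [Fact p.Prime] [CharP K p] {s : State K}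
    (hord : ordZero s.F = p) (he : RidgeBudget.ebar s.F = 1) {j : Fin 4} {b : Fin 4 → K}
    (hbj : b j = 0) (heq : CentreBlowup.IsEquimultiplePoint p Finset.univ j b s) :
    RidgeBudget.ebar (CentreBlowup.step p Finset.univ j b s).F = 0 ∨
      RidgeBudget.ebar (CentreBlowup.step p Finset.univ j b s).F = 1 := by
  have h := ebar_step_le_one p hord he hbj heq
  omega

/-! ## 3. L3: the new ridge is transversal to the exceptional hyperplane `{w_j = 0}` -/

/-- **L3 (ridge transversality).**  At a state of order `p` with `ē = 1`, after blowing up the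
(ridge) point `(j, b)`: a vector of the successor's additive subspace `A(in s⁺.F)` which is tangent
to the exceptional hyperplane, `w'_j = 0`, is zero.  Case `ē(s⁺) = 0`: `A = ⊥`.  Case `ē(s⁺) = 1 =
ē(s)`: the point is very near, so `A(in s⁺.F) ⋔ {w_j = 0}` ([CJS 2020] Def. 3.13 (2) and Thm 9.3;
tree `IsolatedBand.isTransversal_of_finrank_eq`), and on a transversal line every non-zero vector has
`w'_j ≠ 0` (`IsolatedBand.apply_ne_zero_of_isTransversal_singleton`).
[cite: CossartJannsenSaito2020, Thm. 3.10 (4), Def. 3.13 (2) and Thm. 9.3] -/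
theorem eq_zero_of_mem_additiveSubspace_step (p : ℕ) [Fact p.Prime] [CharP K p] {s : State K}
    (hord : ordZero s.F = p) (he : RidgeBudget.ebar s.F = 1) {j : Fin 4} {b : Fin 4 → K}
    (hbj : b j = 0) (heq : CentreBlowup.IsEquimultiplePoint p Finset.univ j b s) {w' : Fin 4 → K}
    (hw' : w' ∈ additiveSubspace (initialForm (CentreBlowup.step p Finset.univ j b s).F))
    (hj : w' j = 0) : w' = 0 := by
  have hgrad := gradSpan_ne_bot_of_ebar_eq_one he
  have hle := Directrix.finrank_additiveSubspace_step_le p hord hgrad hbj heq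
  rw [RidgeBudget.ebar] at he
  by_contra hne
  by_cases h0 :
      Module.finrank K (additiveSubspace (initialForm (CentreBlowup.step p Finset.univ j b s).F)) = 0
  · have hbot : additiveSubspace (initialForm (CentreBlowup.step p Finset.univ j b s).F) = ⊥ :=
      Submodule.finrank_eq_zero.mp h0
    rw [hbot, Submodule.mem_bot] at hw'
    exact hne hw'
  · have h1 :
        Module.finrank K (additiveSubspace (initialForm (CentreBlowup.step p Finset.univ j b s).F)) =
          1 := by omega
    have htr := IsolatedBand.isTransversal_of_finrank_eq p hord hgrad hbj heq (h1.trans he.symm)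
    exact IsolatedBand.apply_ne_zero_of_isTransversal_singleton htr h1 hw' hne hj

/-- **`RidgeTransversal p p`, literal form** (the body of idea-3's stub `RidgeBudget.RidgeTransversal`
at `q = p`, `NarrowLine.lean` 12405623f2353fc4; adapter `fun K _ _ _ => ridgeTransversal p K` once the
stub is in the tree). [cite: CossartJannsenSaito2020, Thm. 3.10 (4), Def. 3.13 (2) and Thm. 9.3] -/
theorem ridgeTransversal (p : ℕ) [Fact p.Prime] (K : Type) [Field K] [CharP K p] [DecidableEq K]
    (s : State K) (j : Fin 4) (b : Fin 4 → K) :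
    ordZero s.F = p → RidgeBudget.ebar s.F = 1 → b j = 0 →
      CentreBlowup.IsEquimultiplePoint p Finset.univ j b s →
        ∀ w' ∈ additiveSubspace (initialForm (CentreBlowup.step p Finset.univ j b s).F),
          w' j = 0 → w' = 0 :=
  fun hord he hbj heq _ hw' hj => eq_zero_of_mem_additiveSubspace_step p hord he hbj heq hw' hj

/-! ## 4. The form the assembly consumes: in the case `ē(s⁺) = 1` the new ridge is a line `K·w'`
with `w'_j ≠ 0`, so L1 applies to `s⁺` in the same chart coordinate `x_j` -/

/-- Every NON-ZERO vector of the successor's additive subspace has `w'_j ≠ 0`. [folklore] -/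
theorem apply_ne_zero_of_mem_additiveSubspace_step (p : ℕ) [Fact p.Prime] [CharP K p] {s : State K}
    (hord : ordZero s.F = p) (he : RidgeBudget.ebar s.F = 1) {j : Fin 4} {b : Fin 4 → K}
    (hbj : b j = 0) (heq : CentreBlowup.IsEquimultiplePoint p Finset.univ j b s) {w' : Fin 4 → K}
    (hw' : w' ∈ additiveSubspace (initialForm (CentreBlowup.step p Finset.univ j b s).F))
    (hw0 : w' ≠ 0) : w' j ≠ 0 :=
  fun hj => hw0 (eq_zero_of_mem_additiveSubspace_step p hord he hbj heq hw' hj)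

/-- **Case `ē(s⁺) = 1`: a ridge vector with `w'_j ≠ 0` exists** (and spans, next lemma). [folklore] -/
theorem exists_ridge_vector_step (p : ℕ) [Fact p.Prime] [CharP K p] {s : State K}
    (hord : ordZero s.F = p) (he : RidgeBudget.ebar s.F = 1) {j : Fin 4} {b : Fin 4 → K}
    (hbj : b j = 0) (heq : CentreBlowup.IsEquimultiplePoint p Finset.univ j b s)
    (he' : RidgeBudget.ebar (CentreBlowup.step p Finset.univ j b s).F = 1) :
    ∃ w' : Fin 4 → K, w' ∈ additiveSubspace (initialForm (CentreBlowup.step p Finset.univ j b s).F) ∧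
      w' j ≠ 0 := by
  have hne : additiveSubspace (initialForm (CentreBlowup.step p Finset.univ j b s).F) ≠ ⊥ := by
    intro hbot
    rw [RidgeBudget.ebar, hbot, finrank_bot] at he'
    exact zero_ne_one he'
  obtain ⟨w', hw', hw0⟩ := Submodule.exists_mem_ne_zero_of_ne_bot hne
  exact ⟨w', hw', apply_ne_zero_of_mem_additiveSubspace_step p hord he hbj heq hw' hw0⟩

omit [DecidableEq K] in
/-- **Case `ē(s⁺) = 1`: the new ridge is the line through any of its non-zero vectors**, in
particular through a vector with `w'_j ≠ 0`. [folklore] -/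
theorem additiveSubspace_step_eq_span {F : MvPolynomial (Fin 4) K} (he' : RidgeBudget.ebar F = 1)
    {w' : Fin 4 → K} (hw' : w' ∈ additiveSubspace (initialForm F)) (hw0 : w' ≠ 0) :
    additiveSubspace (initialForm F) = K ∙ w' := by
  rw [RidgeBudget.ebar] at he'
  have hle : K ∙ w' ≤ additiveSubspace (initialForm F) :=
    (Submodule.span_singleton_le_iff_mem _ _).mpr hw'
  refine (Submodule.eq_of_le_of_finrank_eq hle ?_).symm
  rw [finrank_span_singleton hw0, he']

end Step

end NarrowTransversal

end Summit.ResolutionOfSingularities.ResolutionOfSingularities.Theorems.PIDim4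

end
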